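import Summits.AtomisticToContinuum.Crystallization.Theorems.FrustratedLawDichotomyLocalCloseOrderStability
import Summits.AtomisticToContinuum.Crystallization.Theorems.RepetitiveNetworkReductionRecurrentMember
import Literature.MathematicalPhysics.StatisticalMechanics.LocalMatchingCompactness

/-!
# FrustratedLawDichotomy · crux `AperiodicFrustratedLawGap` (stmt-AtomisticToContinuum-27623) — UNIFORM LOCAL CLOSE ORDER BY COMPACTNESS:
# if every exact μ-equilibrium of `V_LJ` has a close-packed site, then close-packed sites are RELATIVELY DENSE in every exact
# μ-equilibrium, with UNIFORM margins (decomp-a2c, prover hand 2, structural share, generation 7)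

`LCO` (the local-close-order statement of `FrustratedLawDichotomyLocalCloseOrder`, whose door closes the crux given `MuEquilibriumDoor`):
every rooted `7/10`-separated `e⋆`-μGSC `X ⊆ ℝ³` of `V_LJ` has a robustly good atom (fcc or hcp; scale `d`, tolerance `η < 1/20`,
gap `γ > 0`).  This file proves that `LCO` SELF-IMPROVES:

* `localCloseOrder_uniform` : `LCO →` there is ONE `k : ℕ` such that every rooted `7/10`-separated `e⋆`-μGSC of `V_LJ` has a robustly good
  atom of norm `≤ k` whose margins are uniform: `η + 1/(k+1) ≤ 1/20` and `γ ≥ 1/(k+1)`;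
* `localCloseOrder_relDense` : `LCO →` with the same `k`, in every `7/10`-separated `e⋆`-μGSC of `V_LJ` EVERY atom `q` has a robustly good
  atom within distance `k`, with those uniform margins — close-packed sites are `k`-relatively dense among the atoms.

Proof (minimal-counterexample / compactness): were there, for every `k`, a rooted separated `e⋆`-μGSC `X_k` with no such atom, a
subsequence converges in the local matching topology (`Literature…exists_subseq_forall_eventually_ballMatch`, Baake–Lenz compactness of
uniformly discrete sets) to a rooted `7/10`-separated `Y`, which is again an `e⋆`-μGSC (`RepetitiveNetworkReductionRecurrentMember.isMuGSC_of_limit`,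
lens-2's local-limit stability of Sütő's inequalities); `LCO` gives a robustly good atom of `Y`, and robust goodness is OPEN
(`FrustratedLawDichotomyLocalCloseOrderStability.robustGood_transfer`): it reappears, with halved margins, in every `X_k` close enough to `Y` —
contradiction for `k` large.  Relative density is the uniform statement re-rooted at each atom (`isMuGSC_image_sub`).
Reading for the census: to refute `LCO` it suffices to exhibit exact μ-equilibria with ARBITRARILY LARGE close-order-free balls, or with
close order only at vanishing margins; conversely under `LCO` a positive DENSITY of robustly good sites (`≥ 1/#B(k)` per `k`-ball of atoms)
is automatic.  `[folklore]` bookkeeping.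
-/

noncomputable section

namespace Summit.AtomisticToContinuum.Crystallization.Theorems.FrustratedLawDichotomyLocalCloseOrderUniform

open Filter Topology Metric
open Literature.MathematicalPhysics.StatisticalMechanics
open Literature.Geometry.DiscreteGeometry
open Summit.AtomisticToContinuum.Crystallization.Theorems.FrustratedLawDichotomyLocalCloseOrderStability (robustGood_transfer eq_of_dist_lt)
open Summit.AtomisticToContinuum.Crystallization.Theorems.RepetitiveNetworkReductionRecurrentMember (isMuGSC_of_limit isMuGSC_image_sub)

/-- The root survives local limits: a `7/10`-separated set with atoms of arbitrarily small norm contains `0`. [folklore] -/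
theorem zero_mem_of_forall_exists_norm_le {Y : Set (EuclideanSpace ℝ (Fin 3))}
    (hY : ∀ a ∈ Y, ∀ b ∈ Y, a ≠ b → (7 : ℝ) / 10 ≤ dist a b) (h : ∀ ε : ℝ, 0 < ε → ∃ s ∈ Y, ‖s‖ ≤ ε) : (0 : EuclideanSpace ℝ (Fin 3)) ∈ Y := by
  obtain ⟨s₁, hs₁Y, hs₁⟩ := h (1 / 4) (by norm_num)
  suffices hs : s₁ = 0 by rwa [hs] at hs₁Y
  by_contra hne
  have hpos : 0 < ‖s₁‖ := norm_pos_iff.2 hne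
  obtain ⟨s, hsY, hs⟩ := h (min (‖s₁‖ / 2) (1 / 4)) (by positivity)
  have hss₁ : s = s₁ := by
    refine eq_of_dist_lt hY hsY hs₁Y ?_
    calc dist s s₁ ≤ ‖s‖ + ‖s₁‖ := dist_le_norm_add_norm s s₁
      _ < 7 / 10 := by linarith [min_le_right (‖s₁‖ / 2) (1 / 4)]
  rw [hss₁] at hs
  linarith [min_le_left (‖s₁‖ / 2) (1 / 4)]

/-- **UNIFORM LOCAL CLOSE ORDER.**  Under `LCO`, one `k : ℕ` serves every rooted `7/10`-separated `e⋆`-μGSC of `V_LJ`: it has a robustly good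
atom of norm `≤ k` with margins `η + 1/(k+1) ≤ 1/20`, `γ ≥ 1/(k+1)`.  Compactness in the local matching topology + stability of Sütő's
inequalities under local limits + openness of robust goodness (module docstring). [folklore] -/
theorem localCloseOrder_uniform
    (hLCO : ∀ X : Set (EuclideanSpace ℝ (Fin 3)), (0 : EuclideanSpace ℝ (Fin 3)) ∈ X → (∀ a ∈ X, ∀ b ∈ X, a ≠ b → (7 : ℝ) / 10 ≤ dist a b) → Literature.MathematicalPhysics.StatisticalMechanics.IsMuGSC Literature.MathematicalPhysics.StatisticalMechanics.lennardJones (⨅ Q : Literature.MathematicalPhysics.StatisticalMechanics.PeriodicConfiguration 3, Q.energyPerParticle Literature.MathematicalPhysics.StatisticalMechanics.lennardJones) X → ∃ p : EuclideanSpace ℝ (Fin 3), p ∈ X ∧ ∃ (d η γ : ℝ) (A : EuclideanSpace ℝ (Fin 3) →ₗᵢ[ℝ] EuclideanSpace ℝ (Fin 3)), (∃ t : ↥Literature.Geometry.DiscreteGeometry.fccKissingPattern → EuclideanSpace ℝ (Fin 3), 0 < d ∧ 0 < γ ∧ η < 1 / 20 ∧ (∀ u : ↥Literature.Geometry.DiscreteGeometry.fccKissingPattern,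 t u ∈ X ∧ ‖(t u - p) - d • A (u : EuclideanSpace ℝ (Fin 3))‖ ≤ η * d) ∧ (∀ s : EuclideanSpace ℝ (Fin 3), s ∈ X → s ≠ p → d ≤ dist s p) ∧ (∃ s : EuclideanSpace ℝ (Fin 3), s ∈ X ∧ s ≠ p ∧ dist s p ≤ d) ∧ (∀ s : EuclideanSpace ℝ (Fin 3), s ∈ X → s ≠ p → dist s p < 13 / 10 * d + γ → dist s p ≤ 13 / 10 * d - γ ∧ s ∈ Set.range t)) ∨ (∃ t : ↥Literature.Geometry.DiscreteGeometry.hcpKissingPattern → EuclideanSpace ℝ (Fin 3), 0 < d ∧ 0 < γ ∧ η < 1 / 20 ∧ (∀ u : ↥Literature.Geometry.DiscreteGeometry.hcpKissingPattern, t u ∈ X ∧ ‖(t u - p) - d • A (u : EuclideanSpace ℝ (Fin 3))‖ ≤ η * d) ∧ (∀ s : EuclideanSpace ℝ (Fin 3), s ∈ X → s ≠ p → d ≤ dist s p) ∧ (∃ s : EuclideanSpace ℝ (Fin 3), s ∈ X ∧ s ≠ p ∧ dist s p ≤ d) ∧ (∀ s : EuclideanSpace ℝ (Fin 3), s ∈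 X → s ≠ p → dist s p < 13 / 10 * d + γ → dist s p ≤ 13 / 10 * d - γ ∧ s ∈ Set.range t))) :
    ∃ k : ℕ, ∀ X : Set (EuclideanSpace ℝ (Fin 3)), (0 : EuclideanSpace ℝ (Fin 3)) ∈ X → (∀ a ∈ X, ∀ b ∈ X, a ≠ b → (7 : ℝ) / 10 ≤ dist a b) → Literature.MathematicalPhysics.StatisticalMechanics.IsMuGSC Literature.MathematicalPhysics.StatisticalMechanics.lennardJones (⨅ Q : Literature.MathematicalPhysics.StatisticalMechanics.PeriodicConfiguration 3, Q.energyPerParticle Literature.MathematicalPhysics.StatisticalMechanics.lennardJones) X → ∃ p : EuclideanSpace ℝ (Fin 3), p ∈ X ∧ ‖p‖ ≤ k ∧ ∃ (d η γ : ℝ) (A : EuclideanSpace ℝ (Fin 3) →ₗᵢ[ℝ] EuclideanSpace ℝ (Fin 3)), η + 1 / ((k : ℝ) + 1) ≤ 1 / 20 ∧ 1 / ((k : ℝ) + 1) ≤ γ ∧ ((∃ t : ↥Literature.Geometry.DiscreteGeometry.fccKissingPattern → EuclideanSpace ℝ (Fin 3), 0 < d ∧ 0 < γ ∧ η < 1 /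 20 ∧ (∀ u : ↥Literature.Geometry.DiscreteGeometry.fccKissingPattern, t u ∈ X ∧ ‖(t u - p) - d • A (u : EuclideanSpace ℝ (Fin 3))‖ ≤ η * d) ∧ (∀ s : EuclideanSpace ℝ (Fin 3), s ∈ X → s ≠ p → d ≤ dist s p) ∧ (∃ s : EuclideanSpace ℝ (Fin 3), s ∈ X ∧ s ≠ p ∧ dist s p ≤ d) ∧ (∀ s : EuclideanSpace ℝ (Fin 3), s ∈ X → s ≠ p → dist s p < 13 / 10 * d + γ → dist s p ≤ 13 / 10 * d - γ ∧ s ∈ Set.range t)) ∨ (∃ t : ↥Literature.Geometry.DiscreteGeometry.hcpKissingPattern → EuclideanSpace ℝ (Fin 3), 0 < d ∧ 0 < γ ∧ η < 1 / 20 ∧ (∀ u : ↥Literature.Geometry.DiscreteGeometry.hcpKissingPattern, t u ∈ X ∧ ‖(t u - p) - d • A (u : EuclideanSpace ℝ (Fin 3))‖ ≤ η * d) ∧ (∀ s : EuclideanSpace ℝ (Fin 3), s ∈ X → s ≠ p → d ≤ dist s p) ∧ (∃ s : EuclideanSpace ℝ (Fin 3), s ∈ X ∧ s ≠ p ∧ dist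 s p ≤ d) ∧ (∀ s : EuclideanSpace ℝ (Fin 3), s ∈ X → s ≠ p → dist s p < 13 / 10 * d + γ → dist s p ≤ 13 / 10 * d - γ ∧ s ∈ Set.range t))) := by
  by_contra H
  -- for every `k`, a rooted separated `e⋆`-μGSC without a good atom of norm `≤ k` at margin `1/(k+1)`
  have H' : ∀ k : ℕ, ∃ X : Set (EuclideanSpace ℝ (Fin 3)), ((0 : EuclideanSpace ℝ (Fin 3)) ∈ X ∧ (∀ a ∈ X, ∀ b ∈ X, a ≠ b → (7 : ℝ) / 10 ≤ dist a b) ∧ Literature.MathematicalPhysics.StatisticalMechanics.IsMuGSC Literature.MathematicalPhysics.StatisticalMechanics.lennardJones (⨅ Q : Literature.MathematicalPhysics.StatisticalMechanics.PeriodicConfiguration 3, Q.energyPerParticle Literature.MathematicalPhysics.StatisticalMechanics.lennardJones) X) ∧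
      ¬ ∃ p : EuclideanSpace ℝ (Fin 3), p ∈ X ∧ ‖p‖ ≤ k ∧ ∃ (d η γ : ℝ) (A : EuclideanSpace ℝ (Fin 3) →ₗᵢ[ℝ] EuclideanSpace ℝ (Fin 3)), η + 1 / ((k : ℝ) + 1) ≤ 1 / 20 ∧ 1 / ((k : ℝ) + 1) ≤ γ ∧
        ((∃ t : ↥Literature.Geometry.DiscreteGeometry.fccKissingPattern → EuclideanSpace ℝ (Fin 3), 0 < d ∧ 0 < γ ∧ η < 1 / 20 ∧ (∀ u : ↥Literature.Geometry.DiscreteGeometry.fccKissingPattern, t u ∈ X ∧ ‖(t u - p) - d • A (u : EuclideanSpace ℝ (Fin 3))‖ ≤ η * d) ∧ (∀ s : EuclideanSpace ℝ (Fin 3), s ∈ X → s ≠ p → d ≤ dist s p) ∧ (∃ s : EuclideanSpace ℝ (Fin 3), s ∈ X ∧ s ≠ p ∧ dist s p ≤ d) ∧ (∀ s : EuclideanSpace ℝ (Fin 3), s ∈ X → s ≠ p → dist s p < 13 / 10 * d + γ → dist s p ≤ 13 / 10 * d - γ ∧ s ∈ Set.range t)) ∨ (∃ t : ↥Literature.Geometry.DiscreteGeometry.hcpKissingPattern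 → EuclideanSpace ℝ (Fin 3), 0 < d ∧ 0 < γ ∧ η < 1 / 20 ∧ (∀ u : ↥Literature.Geometry.DiscreteGeometry.hcpKissingPattern, t u ∈ X ∧ ‖(t u - p) - d • A (u : EuclideanSpace ℝ (Fin 3))‖ ≤ η * d) ∧ (∀ s : EuclideanSpace ℝ (Fin 3), s ∈ X → s ≠ p → d ≤ dist s p) ∧ (∃ s : EuclideanSpace ℝ (Fin 3), s ∈ X ∧ s ≠ p ∧ dist s p ≤ d) ∧ (∀ s : EuclideanSpace ℝ (Fin 3), s ∈ X → s ≠ p → dist s p < 13 / 10 * d + γ → dist s p ≤ 13 / 10 * d - γ ∧ s ∈ Set.range t))) := by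
    intro k
    by_contra Hk
    refine H ⟨k, fun X h0 hsep hGSC => ?_⟩
    by_contra Hx
    exact Hk ⟨X, ⟨h0, hsep, hGSC⟩, Hx⟩
  choose X hX hbad using H'
  -- a locally convergent subsequence and its limit
  obtain ⟨φ, Y, hφ, hYsep, hconv⟩ :=
    exists_subseq_forall_eventually_ballMatch (d := 3) (by norm_num : (0 : ℝ) < 7 / 10) X fun k => (hX k).2.1
  have h0Y : (0 : EuclideanSpace ℝ (Fin 3)) ∈ Y := by
    refine zero_mem_of_forall_exists_norm_le hYsep fun ε hε => ?_
    obtain ⟨k, hk⟩ := (hconv 1 ε hε).exists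
    obtain ⟨-, hk₂⟩ := hk
    obtain ⟨s, hsY, hs⟩ := hk₂ 0 (hX (φ k)).1 (by rw [dist_self]; norm_num)
    exact ⟨s, hsY, by rwa [dist_comm, dist_zero_right] at hs⟩
  have hYGSC : Literature.MathematicalPhysics.StatisticalMechanics.IsMuGSC Literature.MathematicalPhysics.StatisticalMechanics.lennardJones (⨅ Q : Literature.MathematicalPhysics.StatisticalMechanics.PeriodicConfiguration 3, Q.energyPerParticle Literature.MathematicalPhysics.StatisticalMechanics.lennardJones) Y :=
    isMuGSC_of_limit (by norm_num : (0 : ℝ) < 7 / 10) (fun k => (hX (φ k)).2.1) (fun k => (hX (φ k)).2.2) hYsep hconv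
  -- the limit has a robustly good atom; it transfers to the approximants, with halved margins
  obtain ⟨p, hpY, d, η, γ, A, hgood⟩ := hLCO Y h0Y hYsep hYGSC
  -- common core for a pattern of unit vectors
  have core : ∀ (Pat : Finset (EuclideanSpace ℝ (Fin 3))), Pat.Nonempty → (∀ u ∈ Pat, ‖u‖ = 1) → ∀ t : ↥Pat → EuclideanSpace ℝ (Fin 3),
      (0 < d ∧ 0 < γ ∧ η < 1 / 20 ∧ (∀ u : ↥Pat, t u ∈ Y ∧ ‖(t u - p) - d • A (u : EuclideanSpace ℝ (Fin 3))‖ ≤ η * d) ∧ (∀ s : EuclideanSpace ℝ (Fin 3), s ∈ Y → s ≠ p → d ≤ dist s p) ∧ (∃ s : EuclideanSpace ℝ (Fin 3), s ∈ Y ∧ s ≠ p ∧ dist s p ≤ d) ∧ (∀ s : EuclideanSpace ℝ (Fin 3), s ∈ Y → s ≠ p → dist s p < 13 / 10 * d + γ → dist s p ≤ 13 / 10 * d - γ ∧ s ∈ Set.range t)) →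
      ∃ k : ℕ, ∃ p' : EuclideanSpace ℝ (Fin 3), p' ∈ X (φ k) ∧ ‖p'‖ ≤ (φ k : ℕ) ∧ ∃ d' : ℝ, (1 / 20 + η) / 2 + 1 / (((φ k : ℕ) : ℝ) + 1) ≤ 1 / 20 ∧
        1 / (((φ k : ℕ) : ℝ) + 1) ≤ γ / 2 ∧ ∃ t' : ↥Pat → EuclideanSpace ℝ (Fin 3),
        (0 < d' ∧ 0 < (γ / 2) ∧ ((1 / 20 + η) / 2) < 1 / 20 ∧ (∀ u : ↥Pat, t' u ∈ X (φ k) ∧ ‖(t' u - p') - d' • A (u : EuclideanSpace ℝ (Fin 3))‖ ≤ ((1 / 20 + η) / 2) * d') ∧ (∀ s : EuclideanSpace ℝ (Fin 3), s ∈ X (φ k) → s ≠ p' → d' ≤ dist s p') ∧ (∃ s : EuclideanSpace ℝ (Fin 3), s ∈ X (φ k) ∧ s ≠ p' ∧ dist s p' ≤ d') ∧ (∀ s : EuclideanSpace ℝ (Fin 3), s ∈ X (φ k) → s ≠ p' → dist s p' < 13 / 10 * d' + (γ / 2) → dist s p' ≤ 13 / 10 * d' - (γ / 2) ∧ s ∈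 Set.range t')) := by
    intro Pat hPat hPatn t ⟨hd, hγ, hη, ht, hnn₁, hnn₂, hgap⟩
    -- the matching tolerance
    set ε : ℝ := min (min (γ / 10) ((1 / 20 - η) * d / 10)) (1 / 10) with hεdef
    have hηd : 0 < (1 / 20 - η) * d := mul_pos (by linarith) hd
    have hε : 0 < ε := by positivity
    have hεm : ε ≤ min (γ / 10) ((1 / 20 - η) * d / 10) := min_le_left _ _
    have hm₁ : min (γ / 10) ((1 / 20 - η) * d / 10) ≤ γ / 10 := min_le_left _ _
    have hm₂ : min (γ / 10) ((1 / 20 - η) * d / 10) ≤ (1 / 20 - η) * d / 10 := min_le_right _ _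
    have hε10 : ε ≤ 1 / 10 := min_le_right _ _
    have hεγ : 10 * ε ≤ γ := by linarith
    have hεη : 10 * ε ≤ (1 / 20 - η) * d := by linarith
    have hε7 : 4 * ε < 7 / 10 := by linarith
    have hε1 : ε ≤ 1 := by linarith
    set R : ℝ := ‖p‖ + 13 / 10 * d + γ + ε with hRdef
    -- eventually: matched on `B(0,R)`, index beyond `‖p‖ + 1`, margins below `(1/20 - η)/2` and `γ/2`
    have hφT : Tendsto φ atTop atTop := hφ.tendsto_atTop
    have e1 : ∀ᶠ k in atTop, BallMatch ε R 0 (X (φ k)) Y := hconv R ε hε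
    have e2 : ∀ᶠ k in atTop, ‖p‖ + 1 ≤ ((φ k : ℕ) : ℝ) :=
      (tendsto_natCast_atTop_atTop.comp hφT).eventually_ge_atTop (‖p‖ + 1)
    have hlim : Tendsto (fun k : ℕ => 1 / (((φ k : ℕ) : ℝ) + 1)) atTop (𝓝 0) :=
      tendsto_one_div_add_atTop_nhds_zero_nat.comp hφT
    have e3 : ∀ᶠ k in atTop, 1 / (((φ k : ℕ) : ℝ) + 1) < (1 / 20 - η) / 2 :=
      (tendsto_order.1 hlim).2 _ (by linarith)
    have e4 : ∀ᶠ k in atTop, 1 / (((φ k : ℕ) : ℝ) + 1) < γ / 2 := (tendsto_order.1 hlim).2 _ (by linarith)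
    obtain ⟨k, hk₁, hk₂, hk₃, hk₄⟩ := (e1.and (e2.and (e3.and e4))).exists
    obtain ⟨hmA, hmB⟩ := hk₁
    obtain ⟨p', hp'X, hp'p, d', t', hd'd, hd'pos, ht', hnn₁', hnn₂', hgap'⟩ :=
      robustGood_transfer (hX (φ k)).2.1 (fun s hs hsR => hmA s hs (by rwa [dist_zero_right]))
        (fun a ha haR => hmB a ha (by rwa [dist_zero_right])) hPat hPatn hpY hd hη ht hnn₁ hnn₂ hgap hε hεγ hεη hε7 le_rfl
    refine ⟨k, p', hp'X, ?_, d', by linarith, hk₄.le, t', hd'pos, by linarith, by linarith, ht', hnn₁', hnn₂', hgap'⟩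
    have : ‖p'‖ ≤ ‖p‖ + dist p' p := by
      rw [dist_eq_norm]
      have := norm_add_le p (p' - p)
      rwa [add_sub_cancel] at this
    linarith
  rcases hgood with ⟨t, hg⟩ | ⟨t, hg⟩
  · obtain ⟨k, p', hp', hp'n, d', hm₁, hm₂, t', hg'⟩ :=
      core _ (Finset.card_pos.1 (by rw [card_fccKissingPattern]; norm_num)) (fun u hu => norm_eq_one_of_mem_fccKissingPattern hu) t hg
    exact hbad (φ k) ⟨p', hp', hp'n, d', (1 / 20 + η) / 2, γ / 2, A, hm₁, hm₂, Or.inl ⟨t', hg'⟩⟩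
  · obtain ⟨k, p', hp', hp'n, d', hm₁, hm₂, t', hg'⟩ :=
      core _ (Finset.card_pos.1 (by rw [card_hcpKissingPattern]; norm_num)) (fun u hu => norm_eq_one_of_mem_hcpKissingPattern hu) t hg
    exact hbad (φ k) ⟨p', hp', hp'n, d', (1 / 20 + η) / 2, γ / 2, A, hm₁, hm₂, Or.inr ⟨t', hg'⟩⟩

/-- Robust goodness is translation-covariant: translating the set, the atom and the shell by `q` preserves every clause. [folklore] -/
theorem robustGood_translate {X : Set (EuclideanSpace ℝ (Fin 3))} {q p : EuclideanSpace ℝ (Fin 3)} {Pat : Finset (EuclideanSpace ℝ (Fin 3))}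
    {d η γ : ℝ} {A : EuclideanSpace ℝ (Fin 3) →ₗᵢ[ℝ] EuclideanSpace ℝ (Fin 3)} {t : ↥Pat → EuclideanSpace ℝ (Fin 3)}
    (h : 0 < d ∧ 0 < γ ∧ η < 1 / 20 ∧ (∀ u : ↥Pat, t u ∈ ((fun s => s - q) '' X) ∧ ‖(t u - p) - d • A (u : EuclideanSpace ℝ (Fin 3))‖ ≤ η * d) ∧ (∀ s : EuclideanSpace ℝ (Fin 3), s ∈ ((fun s => s - q) '' X) → s ≠ p → d ≤ dist s p) ∧ (∃ s : EuclideanSpace ℝ (Fin 3), s ∈ ((fun s => s - q) '' X) ∧ s ≠ p ∧ dist s p ≤ d) ∧ (∀ s : EuclideanSpace ℝ (Fin 3), s ∈ ((fun s => s - q) '' X) → s ≠ p → dist s p < 13 / 10 * d + γ → dist s p ≤ 13 / 10 * d - γ ∧ s ∈ Set.range t)) :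
    0 < d ∧ 0 < γ ∧ η < 1 / 20 ∧ (∀ u : ↥Pat, (fun u => t u + q) u ∈ X ∧ ‖((fun u => t u + q) u - (p + q)) - d • A (u : EuclideanSpace ℝ (Fin 3))‖ ≤ η * d) ∧ (∀ s : EuclideanSpace ℝ (Fin 3), s ∈ X → s ≠ (p + q) → d ≤ dist s (p + q)) ∧ (∃ s : EuclideanSpace ℝ (Fin 3), s ∈ X ∧ s ≠ (p + q) ∧ dist s (p + q) ≤ d) ∧ (∀ s : EuclideanSpace ℝ (Fin 3), s ∈ X → s ≠ (p + q) → dist s (p + q) < 13 / 10 * d + γ → dist s (p + q) ≤ 13 / 10 * d - γ ∧ s ∈ Set.range (fun u => t u + q)) := by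
  obtain ⟨hd, hγ, hη, ht, hnn₁, hnn₂, hgap⟩ := h
  have hmem : ∀ s : EuclideanSpace ℝ (Fin 3), s ∈ (fun s => s - q) '' X ↔ s + q ∈ X := fun s => by
    constructor
    · rintro ⟨x, hx, rfl⟩; simpa using hx
    · intro hs; exact ⟨s + q, hs, by simp⟩
  have hdist : ∀ s : EuclideanSpace ℝ (Fin 3), dist s (p + q) = dist (s - q) p := fun s => by
    rw [dist_eq_norm, dist_eq_norm]; congr 1; abel
  refine ⟨hd, hγ, hη, fun u => ⟨(hmem _).1 (ht u).1, ?_⟩, fun s hs hsp => ?_, ?_, fun s hs hsp hlt => ?_⟩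
  · have : (t u + q - (p + q)) = t u - p := by abel
    rw [this]; exact (ht u).2
  · rw [hdist]
    exact hnn₁ (s - q) ((hmem _).2 (by simpa using hs)) (fun h => hsp (by rw [← sub_add_cancel s q, h]))
  · obtain ⟨s, hs, hsp, hsd⟩ := hnn₂
    refine ⟨s + q, (hmem s).1 hs, fun h => hsp (by simpa using congrArg (· - q) h), ?_⟩
    rw [hdist]; simpa using hsd
  · rw [hdist] at hlt ⊢
    obtain ⟨h1, u, hu⟩ := hgap (s - q) ((hmem _).2 (by simpa using hs)) (fun h => hsp (by rw [← sub_add_cancel s q, h])) hlt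
    exact ⟨h1, u, by simp only [hu, sub_add_cancel]⟩

/-- **CLOSE-PACKED SITES ARE RELATIVELY DENSE IN EVERY EXACT μ-EQUILIBRIUM (under `LCO`).**  With the `k` of `localCloseOrder_uniform`:
in every `7/10`-separated `e⋆`-μGSC of `V_LJ`, every atom `q` has a robustly good atom within distance `k`, with margins
`η + 1/(k+1) ≤ 1/20`, `γ ≥ 1/(k+1)`.  Re-root at `q` (`isMuGSC_image_sub`) and translate back (`robustGood_translate`). [folklore] -/
theorem localCloseOrder_relDense
    (hLCO : ∀ X : Set (EuclideanSpace ℝ (Fin 3)), (0 : EuclideanSpace ℝ (Fin 3)) ∈ X → (∀ a ∈ X, ∀ b ∈ X, a ≠ b → (7 : ℝ) / 10 ≤ dist a b) → Literature.MathematicalPhysics.StatisticalMechanics.IsMuGSC Literature.MathematicalPhysics.StatisticalMechanics.lennardJones (⨅ Q : Literature.MathematicalPhysics.StatisticalMechanics.PeriodicConfiguration 3, Q.energyPerParticle Literature.MathematicalPhysics.StatisticalMechanics.lennardJones) X → ∃ p : EuclideanSpace ℝ (Fin 3), p ∈ X ∧ ∃ (d η γ : ℝ) (A : EuclideanSpace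 ℝ (Fin 3) →ₗᵢ[ℝ] EuclideanSpace ℝ (Fin 3)), (∃ t : ↥Literature.Geometry.DiscreteGeometry.fccKissingPattern → EuclideanSpace ℝ (Fin 3), 0 < d ∧ 0 < γ ∧ η < 1 / 20 ∧ (∀ u : ↥Literature.Geometry.DiscreteGeometry.fccKissingPattern, t u ∈ X ∧ ‖(t u - p) - d • A (u : EuclideanSpace ℝ (Fin 3))‖ ≤ η * d) ∧ (∀ s : EuclideanSpace ℝ (Fin 3), s ∈ X → s ≠ p → d ≤ dist s p) ∧ (∃ s : EuclideanSpace ℝ (Fin 3), s ∈ X ∧ s ≠ p ∧ dist s p ≤ d) ∧ (∀ s : EuclideanSpace ℝ (Fin 3), s ∈ X → s ≠ p → dist s p < 13 / 10 * d + γ → dist s p ≤ 13 / 10 * d - γ ∧ s ∈ Set.range t)) ∨ (∃ t : ↥Literature.Geometry.DiscreteGeometry.hcpKissingPattern → EuclideanSpace ℝ (Fin 3), 0 < d ∧ 0 < γ ∧ η < 1 / 20 ∧ (∀ u : ↥Literature.Geometry.DiscreteGeometry.hcpKissingPattern, t u ∈ X ∧ ‖(t u - p) - d • A (u : EuclideanSpace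 ℝ (Fin 3))‖ ≤ η * d) ∧ (∀ s : EuclideanSpace ℝ (Fin 3), s ∈ X → s ≠ p → d ≤ dist s p) ∧ (∃ s : EuclideanSpace ℝ (Fin 3), s ∈ X ∧ s ≠ p ∧ dist s p ≤ d) ∧ (∀ s : EuclideanSpace ℝ (Fin 3), s ∈ X → s ≠ p → dist s p < 13 / 10 * d + γ → dist s p ≤ 13 / 10 * d - γ ∧ s ∈ Set.range t))) :
    ∃ k : ℕ, ∀ X : Set (EuclideanSpace ℝ (Fin 3)), (∀ a ∈ X, ∀ b ∈ X, a ≠ b → (7 : ℝ) / 10 ≤ dist a b) → Literature.MathematicalPhysics.StatisticalMechanics.IsMuGSC Literature.MathematicalPhysics.StatisticalMechanics.lennardJones (⨅ Q : Literature.MathematicalPhysics.StatisticalMechanics.PeriodicConfiguration 3, Q.energyPerParticle Literature.MathematicalPhysics.StatisticalMechanics.lennardJones) X → ∀ q ∈ X, ∃ p : EuclideanSpace ℝ (Fin 3), p ∈ X ∧ dist p q ≤ k ∧ ∃ (d η γ : ℝ) (A : EuclideanSpace ℝ (Fin 3) →ₗᵢ[ℝ] EuclideanSpace ℝ (Fin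 3)), η + 1 / ((k : ℝ) + 1) ≤ 1 / 20 ∧ 1 / ((k : ℝ) + 1) ≤ γ ∧ ((∃ t : ↥Literature.Geometry.DiscreteGeometry.fccKissingPattern → EuclideanSpace ℝ (Fin 3), 0 < d ∧ 0 < γ ∧ η < 1 / 20 ∧ (∀ u : ↥Literature.Geometry.DiscreteGeometry.fccKissingPattern, t u ∈ X ∧ ‖(t u - p) - d • A (u : EuclideanSpace ℝ (Fin 3))‖ ≤ η * d) ∧ (∀ s : EuclideanSpace ℝ (Fin 3), s ∈ X → s ≠ p → d ≤ dist s p) ∧ (∃ s : EuclideanSpace ℝ (Fin 3), s ∈ X ∧ s ≠ p ∧ dist s p ≤ d) ∧ (∀ s : EuclideanSpace ℝ (Fin 3), s ∈ X → s ≠ p → dist s p < 13 / 10 * d + γ → dist s p ≤ 13 / 10 * d - γ ∧ s ∈ Set.range t)) ∨ (∃ t : ↥Literature.Geometry.DiscreteGeometry.hcpKissingPattern → EuclideanSpace ℝ (Fin 3), 0 < d ∧ 0 < γ ∧ η < 1 / 20 ∧ (∀ u : ↥Literature.Geometry.DiscreteGeometry.hcpKissingPattern, t u ∈ X ∧ ‖(t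 u - p) - d • A (u : EuclideanSpace ℝ (Fin 3))‖ ≤ η * d) ∧ (∀ s : EuclideanSpace ℝ (Fin 3), s ∈ X → s ≠ p → d ≤ dist s p) ∧ (∃ s : EuclideanSpace ℝ (Fin 3), s ∈ X ∧ s ≠ p ∧ dist s p ≤ d) ∧ (∀ s : EuclideanSpace ℝ (Fin 3), s ∈ X → s ≠ p → dist s p < 13 / 10 * d + γ → dist s p ≤ 13 / 10 * d - γ ∧ s ∈ Set.range t))) := by
  obtain ⟨k, hk⟩ := localCloseOrder_uniform hLCO
  refine ⟨k, fun X hsep hGSC q hq => ?_⟩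
  have hsep' : ∀ a ∈ (fun s => s - q) '' X, ∀ b ∈ (fun s => s - q) '' X, a ≠ b → (7 : ℝ) / 10 ≤ dist a b := by
    rintro _ ⟨a, ha, rfl⟩ _ ⟨b, hb, rfl⟩ hne
    rw [dist_sub_right]
    exact hsep a ha b hb fun h => hne (by rw [h])
  have h0 : (0 : EuclideanSpace ℝ (Fin 3)) ∈ (fun s => s - q) '' X := ⟨q, hq, sub_self q⟩
  obtain ⟨p, hp, hpn, d, η, γ, A, hm₁, hm₂, hgood⟩ :=
    hk _ h0 hsep' (isMuGSC_image_sub (by norm_num : (0 : ℝ) < 7 / 10) hsep hGSC q)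
  refine ⟨p + q, ?_, ?_, d, η, γ, A, hm₁, hm₂, ?_⟩
  · obtain ⟨x, hx, hxp⟩ := hp
    have : x = p + q := by rw [← hxp, sub_add_cancel]
    rwa [← this]
  · rwa [dist_eq_norm, add_sub_cancel_right]
  · rcases hgood with ⟨t, hg⟩ | ⟨t, hg⟩
    · exact Or.inl ⟨fun u => t u + q, robustGood_translate hg⟩
    · exact Or.inr ⟨fun u => t u + q, robustGood_translate hg⟩

end Summit.AtomisticToContinuum.Crystallization.Theorems.FrustratedLawDichotomyLocalCloseOrderUniform

end
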